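import Summits.RiemannHypothesis.RiemannHypothesis.Theorems.Splittings.NbMoebiusLock
import Summits.RiemannHypothesis.RiemannHypothesis.Theorems.Splittings.NbCoefficientSign
import HarnessLib

/-!
# RH-EQUIVALENT·SPLITTING CENSUS (nb, neg) · V36 part C «MÖBIUS LOCK, ALL INDICES» (file 2 of 2): under a sup-norm budget EVERY coefficient of a Nyman–Beurling approximant is locked to the Möbius value, `a_j → μ(j+1)`, uniformly in `N` and without any zero of `ζ` — the SIGN LAW of the census: no budgeted approximant family has a wrongly signed coefficient at a squarefree index, or a non-negligible one at a non-squarefree index; nothing here bears on the truth of RH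

LABEL (line 1): RH-EQUIVALENT·SPLITTING (cell `rh-split`, seat (nb, neg), generation 11, census
candidate V36, part C, file 2 of 2; re-opens the namespace of `Splittings.NbMoebiusLock`).
Continuation of `Splittings.NbCoefficientSign` (part A: the real-axis point law
`norm_one_sub_zeta_mul_dirichletPoly_le_real`, the only input taken from it).  Object: the full
PROFILE of the coefficient vector `a` of `A(s) = Σ_{n<N} a_n (n+1)^{-s}` in the route's integral
`I(N,a) = ∫ |1 - ζA|²(1/2+it) dt/(1/4+t²)` (`Theses.NymanBeurling.NbThesis`, verbatim integrand)
under a SUP-NORM BUDGET `‖a_n‖ ≤ M ∀ n`.  Zero definitions; standard axioms; NO zero of `ζ` is used.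

## Results (this file)

* `lseries_ext_eq_dirichletPoly`: `A = L F` for the shifted, zero-extended coefficient sequence `F`.
* `norm_coeff_sub_moebius_le_of_pointBound`: the lock from point bounds `|1 - ζ(k)A(k)| ≤ e·K(k)`,
  `K(k) = k²(k+1)²/((k-½)(k-1))`, at the natural points `k ≥ 4`.
* **`nbMoebiusLock`**: `∀ j M, ∀ η > 0, ∃ ε > 0, ∀ N (a : Fin N → ℂ) (j < N), ‖a_n‖ ≤ M ∀ n →
  I(N,a) ≤ ε → ‖a_j - μ(j+1)‖ ≤ η` — every coefficient of a budgeted near-approximant is near its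
  MÖBIUS value (Báez-Duarte's «inevitability of the natural approximation», arXiv:math/0011254
  Lemma 4.2 / Remark 4.7, there qualitative, for pointwise-convergent sequences in Beurling's
  function space; Landreau–Richard, Exp. Math. 11 (2002) p. 352, numerically and under RH), here
  zero-free,
  uniform in `N`, on the Dirichlet-polynomial functional, using only part A's real-axis point law
  `|1 - ζ(k)A(k)| ≤ √I·K(k)`, the value `Σ 1/m² = π²/6`, and Möbius inversion (file 1).
* REFUTED CONJUNCTS (every index `j`, budget `M`, `δ > 0`): **`not_nbCoeffOffMoebiusBddApprox`**
  («`‖a_j - μ(j+1)‖ ≥ δ`»), **`not_nbWrongSignBddApprox`** («`Re(a_j)·μ(j+1) ≤ 0` at a squarefree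
  index»: the SIGN LAW), **`not_nbNonSquarefreeCoeffBddApprox`** («`‖a_j‖ ≥ δ` at a non-squarefree
  index»: the VANISHING LAW).  Each conjunct trivially implies `NbThesis` (RH-PLUS: forget the
  constraint); here each is false outright, for every `M`.

## The argument

With `F(n) = a_{n-1}` (`1 ≤ n ≤ N`, else `0`) one has `A = L F` and `ζ·A - 1 = L g`,
`g = ζ * F - δ` (Dirichlet convolution), `‖g(m)‖ ≤ (M+1)m`, and part A gives
`‖L g(k)‖ = |1 - ζ(k)A(k)| ≤ √I·K(k)` at every natural `k ≥ 4` with NO zero of `ζ`.  File 1's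
effective uniqueness gives `‖g(m)‖ ≤ η/(j+1)` for `m ≤ j+1` once `I ≤ ε(j, M, η)`, uniformly in `N`
and `a`; Möbius inversion `F = μ * (ζ * F)` turns this into `‖a_j - μ(j+1)‖ ≤ η`.  The `ε` is not
made explicit; explicit rates for `j = 0, 1` are in part B (`Splittings.NbCoefficientLock`).  The
budget is essential for the method (Müntz: without it nothing pointwise survives, cf. the card §17).

HONEST LABEL: «SPLITTING SEARCH over kernel-typed RH-EQUIVALENCES; a splitting A ∧ B ⟹ RH is
CONDITIONAL bookkeeping unless A and B are both proved; nothing here bears on the truth of RH.»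
-/

set_option linter.dupNamespace false

noncomputable section

open Complex MeasureTheory Filter Topology Finset
open scoped Real ArithmeticFunction.Moebius ArithmeticFunction.zeta

namespace Summit.RiemannHypothesis.RiemannHypothesis.Theorems.Splittings.NbMoebiusLock

open Literature.NumberTheory.LFunctions
open Summit.RiemannHypothesis.RiemannHypothesis.Theorems.Splittings.NbCoefficientSign

/-! ## Part 3: the Dirichlet polynomial of `a : Fin N → ℂ` as an L-series; the lock -/

/-- The L-series of the (zero-extended, shifted) coefficient sequence of `a : Fin N → ℂ` is the
Dirichlet polynomial `A_a(s) = Σ_{n<N} a_n (n+1)^{-s}`. -/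
theorem lseries_ext_eq_dirichletPoly {N : ℕ} (a : Fin N → ℂ) (s : ℂ) :
    LSeries (fun n : ℕ ↦ if h : 0 < n ∧ n ≤ N then a ⟨n - 1, by omega⟩ else 0) s =
      dirichletPoly a s := by
  set F : ℕ → ℂ := fun n : ℕ ↦ if h : 0 < n ∧ n ≤ N then a ⟨n - 1, by omega⟩ else 0 with hFdef
  have hF0 : ∀ n, ¬ (0 < n ∧ n ≤ N) → F n = 0 := fun n hn ↦ by rw [hFdef]; exact dif_neg hn
  have hFsucc : ∀ i : Fin N, F ((i : ℕ) + 1) = a i := by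
    intro i
    rw [hFdef]
    simp only
    rw [dif_pos ⟨Nat.succ_pos _, i.2⟩]
    congr 1
  rw [LSeries, tsum_eq_sum (s := Finset.range (N + 1)) (fun n hn ↦ ?_)]
  swap
  · rw [Finset.mem_range, not_lt] at hn
    rw [LSeries.term_def, hF0 n (by omega)]
    simp
  rw [Finset.sum_range_succ', LSeries.term_def, if_pos rfl, add_zero, dirichletPoly_apply,
    ← Fin.sum_univ_eq_sum_range (fun i ↦ LSeries.term F s (i + 1)) N]
  refine Finset.sum_congr rfl fun i _ ↦ ?_
  rw [LSeries.term_of_ne_zero (Nat.succ_ne_zero _), hFsucc i, div_eq_mul_inv, ← Complex.cpow_neg]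
  push_cast
  ring

open ArithmeticFunction in
/-- **THE LOCK from point bounds (uniform, zero-free).** For every index `j`, budget `M` and
`η > 0` there is `e > 0` such that every Dirichlet polynomial with `‖a_n‖ ≤ M` and
`|1 - ζ(k)A(k)| ≤ e·K(k)` at all natural points `k ≥ 4` has `‖a_j - μ(j+1)‖ ≤ η`. -/
theorem norm_coeff_sub_moebius_le_of_pointBound (j : ℕ) (M η : ℝ) (hη : 0 < η) :
    ∃ e : ℝ, 0 < e ∧ ∀ (N : ℕ) (a : Fin N → ℂ) (hj : j < N), (∀ n, ‖a n‖ ≤ M) →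
      (∀ k : ℕ, 4 ≤ k → ‖1 - riemannZeta k * dirichletPoly a k‖ ≤
        e * ((k : ℝ) ^ 2 * ((k : ℝ) + 1) ^ 2 / (((k : ℝ) - 1 / 2) * ((k : ℝ) - 1)))) →
      ‖a ⟨j, hj⟩ - (μ (j + 1) : ℂ)‖ ≤ η := by
  set B : ℕ → ℝ := fun k ↦ (k : ℝ) ^ 2 * ((k : ℝ) + 1) ^ 2 / (((k : ℝ) - 1 / 2) * ((k : ℝ) - 1))
    with hBdef
  have hB : ∀ k, 0 ≤ B k := by
    intro k
    rcases Nat.eq_zero_or_pos k with rfl | hk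
    · simp [hBdef]
    · have hk1 : (1 : ℝ) ≤ k := by exact_mod_cast hk
      exact div_nonneg (by positivity) (mul_nonneg (by linarith) (by linarith))
  have hη' : 0 < η / ((j : ℝ) + 1) := by positivity
  obtain ⟨e, he, hlock⟩ :=
    dirichletCoeff_small_of_lseries_small (j + 1) (M + 1) B (η / ((j : ℝ) + 1)) hB hη'
  refine ⟨e, he, fun N a hj hM hpt ↦ ?_⟩
  have hM0 : 0 ≤ M := (norm_nonneg _).trans (hM ⟨j, hj⟩)
  -- the extended coefficient sequence and its divisor sums
  set F : ℕ → ℂ := fun n : ℕ ↦ if h : 0 < n ∧ n ≤ N then a ⟨n - 1, by omega⟩ else 0 with hFdef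
  have hFM : ∀ n, ‖F n‖ ≤ M := by
    intro n
    rw [hFdef]; simp only
    split_ifs with h
    · exact hM _
    · simpa using hM0
  set g : ℕ → ℂ := fun n ↦ ((ζ : ArithmeticFunction ℂ) * toArithmeticFunction F) n - LSeries.delta n
    with hgdef
  have hgC : ∀ m, ‖g m‖ ≤ (M + 1) * m := by
    intro m
    rcases eq_or_ne m 0 with rfl | hm
    · simp [hgdef, LSeries.delta]
    have h1 := norm_coe_zeta_mul_toArithmeticFunction_le hM0 hFM m
    have h2 : ‖LSeries.delta m‖ ≤ 1 := by simp only [LSeries.delta]; split_ifs <;> simp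
    have hm1 : (1 : ℝ) ≤ m := by exact_mod_cast Nat.one_le_iff_ne_zero.mpr hm
    calc ‖g m‖ ≤ ‖((ζ : ArithmeticFunction ℂ) * toArithmeticFunction F) m‖ + ‖LSeries.delta m‖ :=
          norm_sub_le _ _
      _ ≤ M * m + 1 := add_le_add h1 h2
      _ ≤ (M + 1) * m := by nlinarith
  have hgL : ∀ k : ℕ, 4 ≤ k → ‖LSeries g (k : ℂ)‖ ≤ e * B k := by
    intro k hk
    rw [hgdef, lseries_coe_zeta_mul_sub_delta hFM (by omega : 2 ≤ k), lseries_ext_eq_dirichletPoly,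
      norm_sub_rev]
    exact hpt k hk
  have hsmall := hlock g hgC hgL
  -- Möbius inversion at `n = j + 1`
  have hinv := norm_sub_moebius_le (F := F) (n := j + 1) (Nat.succ_ne_zero j)
    (fun m hm ↦ hsmall m hm)
  have hFj : F (j + 1) = a ⟨j, hj⟩ := by
    rw [hFdef]; simp only
    rw [dif_pos ⟨Nat.succ_pos _, hj⟩]
    congr 1
  rw [hFj] at hinv
  refine hinv.trans (le_of_eq ?_)
  push_cast
  field_simp



/-! ## Part 4: the Nyman–Beurling lock and the refuted conjuncts -/

open ArithmeticFunction in
/-- **THE MÖBIUS LOCK (V36, all indices; zero-free, uniform).** For every index `j`, budget `M` and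
`η > 0` there is `ε > 0` such that EVERY Dirichlet polynomial `a : Fin N → ℂ` (any `N > j`) with
`‖a_n‖ ≤ M ∀ n` and `I(N,a) ≤ ε` satisfies `‖a_j - μ(j+1)‖ ≤ η`. -/
theorem nbMoebiusLock (j : ℕ) (M η : ℝ) (hη : 0 < η) :
    ∃ ε : ℝ, 0 < ε ∧ ∀ (N : ℕ) (a : Fin N → ℂ) (hj : j < N), (∀ n, ‖a n‖ ≤ M) →
      ∫⁻ t : ℝ, ENNReal.ofReal (‖1 - riemannZeta (1 / 2 + t * Complex.I) *
        ∑ n : Fin N, a n * ((n : ℂ) + 1) ^ (-(1 / 2 + t * Complex.I))‖ ^ 2 / (1 / 4 + t ^ 2)) ≤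
      ENNReal.ofReal ε → ‖a ⟨j, hj⟩ - (μ (j + 1) : ℂ)‖ ≤ η := by
  obtain ⟨e, he, h⟩ := norm_coeff_sub_moebius_le_of_pointBound j M η hη
  refine ⟨e ^ 2, by positivity, fun N a hj hM hI ↦ h N a hj hM fun k hk ↦ ?_⟩
  have hk1 : (1 : ℝ) < (k : ℝ) := by exact_mod_cast (by omega : 1 < k)
  have h' := norm_one_sub_zeta_mul_dirichletPoly_le_real a (sq_nonneg e) hI hk1
  rw [Real.sqrt_sq he.le] at h'
  simpa only [Complex.ofReal_natCast] using h'

open ArithmeticFunction in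
/-- **V36 conjunct «a coefficient off its Möbius value, under budget» REFUTED (every index).** -/
theorem not_nbCoeffOffMoebiusBddApprox (j : ℕ) (M δ : ℝ) (hδ : 0 < δ) :
    ¬ (∀ ε : ℝ, 0 < ε → ∃ (N : ℕ) (a : Fin N → ℂ) (hj : j < N), (∀ n, ‖a n‖ ≤ M) ∧
      δ ≤ ‖a ⟨j, hj⟩ - (μ (j + 1) : ℂ)‖ ∧
      ∫⁻ t : ℝ, ENNReal.ofReal (‖1 - riemannZeta (1 / 2 + t * Complex.I) *
        ∑ n : Fin N, a n * ((n : ℂ) + 1) ^ (-(1 / 2 + t * Complex.I))‖ ^ 2 / (1 / 4 + t ^ 2)) <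
      ENNReal.ofReal ε) := by
  intro h
  obtain ⟨ε, hε, hlock⟩ := nbMoebiusLock j M (δ / 2) (by positivity)
  obtain ⟨N, a, hj, hM, hδa, hlt⟩ := h ε hε
  have := hlock N a hj hM hlt.le
  linarith

open ArithmeticFunction in
/-- **THE SIGN LAW (V36): «wrong sign at a squarefree index, under budget» REFUTED.**  If
`μ(j+1) ≠ 0`, budgeted approximants whose `j`-th coefficient has real part of the wrong sign (or
zero), `Re(a_j)·μ(j+1) ≤ 0`, cannot reach `I < ε(j, M)`. -/
theorem not_nbWrongSignBddApprox (j : ℕ) (M : ℝ) (hμ : μ (j + 1) ≠ 0) :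
    ¬ (∀ ε : ℝ, 0 < ε → ∃ (N : ℕ) (a : Fin N → ℂ) (hj : j < N), (∀ n, ‖a n‖ ≤ M) ∧
      (a ⟨j, hj⟩).re * (μ (j + 1) : ℝ) ≤ 0 ∧
      ∫⁻ t : ℝ, ENNReal.ofReal (‖1 - riemannZeta (1 / 2 + t * Complex.I) *
        ∑ n : Fin N, a n * ((n : ℂ) + 1) ^ (-(1 / 2 + t * Complex.I))‖ ^ 2 / (1 / 4 + t ^ 2)) <
      ENNReal.ofReal ε) := by
  intro h
  apply not_nbCoeffOffMoebiusBddApprox j M 1 one_pos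
  intro ε hε
  obtain ⟨N, a, hj, hM, hsign, hlt⟩ := h ε hε
  refine ⟨N, a, hj, hM, ?_, hlt⟩
  have hre : (a ⟨j, hj⟩ - (μ (j + 1) : ℂ)).re = (a ⟨j, hj⟩).re - (μ (j + 1) : ℝ) := by simp
  refine le_trans ?_ (Complex.abs_re_le_norm _)
  rw [hre]
  rcases moebius_ne_zero_iff_eq_or.mp hμ with h1 | h1 <;> rw [h1] at hsign ⊢ <;>
    push_cast at hsign ⊢
  · rw [le_abs]; right; linarith
  · rw [le_abs]; left; linarith

open ArithmeticFunction in
/-- **THE VANISHING LAW (V36): «a non-negligible coefficient at a non-squarefree index, under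
budget» REFUTED.**  If `μ(j+1) = 0`, budgeted approximants with `‖a_j‖ ≥ δ` cannot reach `I < ε`. -/
theorem not_nbNonSquarefreeCoeffBddApprox (j : ℕ) (M δ : ℝ) (hδ : 0 < δ) (hμ : μ (j + 1) = 0) :
    ¬ (∀ ε : ℝ, 0 < ε → ∃ (N : ℕ) (a : Fin N → ℂ) (hj : j < N), (∀ n, ‖a n‖ ≤ M) ∧
      δ ≤ ‖a ⟨j, hj⟩‖ ∧
      ∫⁻ t : ℝ, ENNReal.ofReal (‖1 - riemannZeta (1 / 2 + t * Complex.I) *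
        ∑ n : Fin N, a n * ((n : ℂ) + 1) ^ (-(1 / 2 + t * Complex.I))‖ ^ 2 / (1 / 4 + t ^ 2)) <
      ENNReal.ofReal ε) := by
  intro h
  apply not_nbCoeffOffMoebiusBddApprox j M δ hδ
  intro ε hε
  obtain ⟨N, a, hj, hM, hδa, hlt⟩ := h ε hε
  refine ⟨N, a, hj, hM, ?_, hlt⟩
  simpa [hμ] using hδa

end Summit.RiemannHypothesis.RiemannHypothesis.Theorems.Splittings.NbMoebiusLock
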